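import Mathlib
import Summits.ValiantsHypothesis.ValiantsHypothesis.Theses.ValuativeGCT
import Summits.ValiantsHypothesis.ValiantsHypothesis.Theorems.ValuativeGCTValuativeFlipFirstRungBiteCentres

/-!
# `ValuativeGCT.ValuativeFlip` (stmt-ValiantsHypothesis-12624), det census — THE CUT BITES IN EVERY EVEN DEGREE,
# AT EVERY `m ≥ 3`

Companion of `ValuativeGCTValuativeFlipFirstRungBite{,Centres}`.  The first-rung witness `G_T` (τ-symmetrised symmetric
level-2 blow-up: degree `m · 2`, `Stab_End(det_m)`-invariant, non-zero at a sparse point of `L_U`) has powers `G_T ^ k`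
with the same three properties in degree `m · (2k)`; highest-weight extraction and the cut criterion therefore give a
strict drop of the valuative truncation in EVERY EVEN DEGREE `δ = 2k ≥ 2`:

* `frp_exists_witness_of_mem` — the certificate of `firstRung_bite_of_mem` as a reusable existence statement: for any
  placement `e : Fin 3 ⊕ κ ≃ Fin m` and any centre `U` containing the skew triangle and a block `0₃ ⊕ Y`, `det Y ≠ 0`,
  there are a form `G` of degree `m · 2`, invariant under the crux's row action of every `M` with `linSubst M det_m = det_m`,
  and a point `p` of `L_U` with `G(p) ≠ 0`;
* `evenDegree_bite_of_mem` — hence for every `k` some `λ ⊢ m · (2k)` (`≤ m²` parts) has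
  `finrank T_U(t, λ*) < finrank T_U(0, λ*)` for every `t ≥ 1` (truncation in degree `m · (2k)`);
* `evenDegree_admissibleCentre_bites` — in the crux's currency: for every `m ≥ 3` and every `k ≥ 1` there are an
  admissible centre `(U, r)` (`Λ_3 ⊕ D_{m-3}`, `r = m - 1`) and `λ ⊢ m · (2k)` with
  `finrank T_U((2k)(m - r), λ*) < finrank T_U(0, λ*)`.
So the route's lever is non-vacuous at every size in every even degree — in particular in the degrees `δ ≥ 4` where the
Kadish–Landsberg shapes of flip witnesses live — while in odd total degree `m δ` no order-0 witness exists by the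
parity law (`CutBites.Negative.cutBites_trunc_one_eq_trunc_zero_of_odd`).

References: BLMW, SIAM J. Comput. 40 (2011) §5.2; M. Domokos, A. N. Zubkov, Transform. Groups 6 (2001) Thm. 1.1.
-/

namespace Summit.ValiantsHypothesis.ValiantsHypothesis.Theorems.ValuativeFlip

open Literature.NumberTheory.DiophantineGeometry Literature.Computability.AlgebraicComplexity
open MvPolynomial
open scoped BigOperators Matrix Kronecker

-- `Summit.ValiantsHypothesis.ValiantsHypothesis.…` is the tree's mandated single-conjunct layout (Sub = Summit).
set_option linter.dupNamespace false

noncomputable section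

/-- **The first-rung certificate as an existence statement**: a `Stab_End(det_m)`-invariant form of degree `m · 2`
non-zero at a point of `L_U` (the body of `firstRung_bite_of_mem` up to highest-weight extraction). [folklore] -/
theorem frp_exists_witness_of_mem {m : ℕ} {κ : Type*} [Fintype κ] [DecidableEq κ] (e : Fin 3 ⊕ κ ≃ Fin m)
    (Y : Matrix κ κ ℂ) (hY : Y.det ≠ 0) (U : Submodule ℂ (MatIdx m → ℂ))
    (hP : (fun i : MatIdx m => Matrix.reindex e e
        (Matrix.fromBlocks (!![0, 1, 0; -1, 0, 0; 0, 0, 0] : Matrix (Fin 3) (Fin 3) ℂ) 0 0 (0 : Matrix κ κ ℂ))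
        (ofLex i).1 (ofLex i).2) ∈ U)
    (hQ : (fun i : MatIdx m => Matrix.reindex e e
        (Matrix.fromBlocks (!![0, 0, 1; 0, 0, 0; -1, 0, 0] : Matrix (Fin 3) (Fin 3) ℂ) 0 0 (0 : Matrix κ κ ℂ))
        (ofLex i).1 (ofLex i).2) ∈ U)
    (hR : (fun i : MatIdx m => Matrix.reindex e e
        (Matrix.fromBlocks (!![0, 0, 0; 0, 0, 1; 0, -1, 0] : Matrix (Fin 3) (Fin 3) ℂ) 0 0 (0 : Matrix κ κ ℂ))
        (ofLex i).1 (ofLex i).2) ∈ U)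
    (hYU : (fun i : MatIdx m => Matrix.reindex e e
        (Matrix.fromBlocks (0 : Matrix (Fin 3) (Fin 3) ℂ) 0 0 Y) (ofLex i).1 (ofLex i).2) ∈ U) :
    ∃ (G : MvPolynomial (MatIdx m × MatIdx m) ℂ) (p : MatIdx m × MatIdx m → ℂ),
      G.IsHomogeneous (m * 2) ∧
      (∀ M : Matrix (MatIdx m) (MatIdx m) ℂ, linSubst (MatIdx m) ℂ M (detFormLex ℂ m) = detFormLex ℂ m →
        MvPolynomial.aeval (R := ℂ) (fun q : MatIdx m × MatIdx m =>
          ∑ l : MatIdx m, M l q.2 • (X (q.1, l) : MvPolynomial (MatIdx m × MatIdx m) ℂ)) G = G) ∧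
      (∀ j : MatIdx m, (fun i => p (j, i)) ∈ U) ∧ MvPolynomial.eval p G ≠ 0 := by
  classical
  -- the three letters and the four row slots
  set c : Fin 3 → Fin m := fun i => e (Sum.inl i) with hc
  have hcinj : Function.Injective c := fun i j h => Sum.inl_injective (e.injective h)
  set jP : MatIdx m := toLex (c 0, c 1) with hjP
  set jQ : MatIdx m := toLex (c 0, c 2) with hjQ
  set jR : MatIdx m := toLex (c 1, c 2) with hjR
  set jY : MatIdx m := toLex (c 0, c 0) with hjY
  have hne : ∀ {a b a' b' : Fin 3}, (a, b) ≠ (a', b') → (toLex (c a, c b) : MatIdx m) ≠ toLex (c a', c b') := by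
    intro a b a' b' h h'
    apply h
    have h'' := toLex.injective h'
    simp only [Prod.mk.injEq] at h'' ⊢
    exact ⟨hcinj h''.1, hcinj h''.2⟩
  have hPQ : jP ≠ jQ := hne (by decide)
  have hPR : jP ≠ jR := hne (by decide)
  have hPY : jP ≠ jY := hne (by decide)
  have hQR : jQ ≠ jR := hne (by decide)
  have hQY : jQ ≠ jY := hne (by decide)
  have hRY : jR ≠ jY := hne (by decide)
  -- the four row matrices
  set MP : Matrix (Fin m) (Fin m) ℂ := Matrix.reindex e e
    (Matrix.fromBlocks (!![0, 1, 0; -1, 0, 0; 0, 0, 0] : Matrix (Fin 3) (Fin 3) ℂ) 0 0 (0 : Matrix κ κ ℂ)) with hMP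
  set MQ : Matrix (Fin m) (Fin m) ℂ := Matrix.reindex e e
    (Matrix.fromBlocks (!![0, 0, 1; 0, 0, 0; -1, 0, 0] : Matrix (Fin 3) (Fin 3) ℂ) 0 0 (0 : Matrix κ κ ℂ)) with hMQ
  set MR : Matrix (Fin m) (Fin m) ℂ := Matrix.reindex e e
    (Matrix.fromBlocks (!![0, 0, 0; 0, 0, 1; 0, -1, 0] : Matrix (Fin 3) (Fin 3) ℂ) 0 0 (0 : Matrix κ κ ℂ)) with hMR
  set MY : Matrix (Fin m) (Fin m) ℂ := Matrix.reindex e e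
    (Matrix.fromBlocks (0 : Matrix (Fin 3) (Fin 3) ℂ) 0 0 Y) with hMY
  -- blow-up data and the point
  set σx : Matrix (Fin 2) (Fin 2) ℂ := !![0, 1; 1, 0] with hσx
  set σz : Matrix (Fin 2) (Fin 2) ℂ := !![1, 0; 0, -1] with hσz
  set T : MatIdx m → Matrix (Fin 2) (Fin 2) ℂ := fun j =>
    if j = jP then 1 else if j = jQ then σx else if j = jR then σz else if j = jY then 1 else 0 with hT
  set S : MatIdx m → Matrix (Fin m) (Fin m) ℂ := fun j =>
    if j = jP then MP else if j = jQ then MQ else if j = jR then MR else if j = jY then MY else 0 with hS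
  set p : MatIdx m × MatIdx m → ℂ := fun q => S q.1 (ofLex q.2).1 (ofLex q.2).2 with hp
  -- all rows of `p` lie in `U`
  have hpU : ∀ j : MatIdx m, (fun i => p (j, i)) ∈ U := by
    intro j
    simp only [hp, hS]
    split_ifs
    · exact hP
    · exact hQ
    · exact hR
    · exact hYU
    · simp only [Matrix.zero_apply]
      exact U.zero_mem
  -- `T` is symmetric
  have hTt : (fun j => (T j)ᵀ) = T := by
    funext j
    simp only [hT]
    split_ifs
    · exact Matrix.transpose_one
    · ext i j; fin_cases i <;> fin_cases j <;> rfl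
    · ext i j; fin_cases i <;> fin_cases j <;> rfl
    · exact Matrix.transpose_one
    · exact Matrix.transpose_zero
  -- the numerical blow-up matrix at `p`
  have hTS : ∀ j, T j ⊗ₖ S j =
      if j = jP then (1 : Matrix (Fin 2) (Fin 2) ℂ) ⊗ₖ MP else if j = jQ then σx ⊗ₖ MQ else
        if j = jR then σz ⊗ₖ MR else if j = jY then (1 : Matrix (Fin 2) (Fin 2) ℂ) ⊗ₖ MY else 0 := by
    intro j
    simp only [hT, hS]
    split_ifs <;> simp
  have hsum : ∑ j : MatIdx m, T j ⊗ₖ S j =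
      (1 : Matrix (Fin 2) (Fin 2) ℂ) ⊗ₖ MP + σx ⊗ₖ MQ + σz ⊗ₖ MR + (1 : Matrix (Fin 2) (Fin 2) ℂ) ⊗ₖ MY := by
    simp only [hTS]
    exact frg_sum_ite_four hPQ hPR hPY hQR hQY hRY _ _ _ _
  have hmat : (Matrix.of fun a b : Fin 2 × Fin m => ∑ j : MatIdx m, T j a.1 b.1 * p (j, toLex (a.2, b.2))) =
      ∑ j : MatIdx m, T j ⊗ₖ S j := by
    simp only [hp]
    exact frg_blowup_point_eq_sum_kronecker T S
  have hdet : MvPolynomial.eval p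
      (Matrix.of fun a b : Fin 2 × Fin m =>
        ∑ j : MatIdx m, T j a.1 b.1 • MvPolynomial.X (R := ℂ) (j, toLex (a.2, b.2))).det ≠ 0 := by
    rw [frg_eval_det_blowup, hmat, hsum, hMP, hMQ, hMR, hMY, hσx, hσz, frg_det_level e Y]
    exact mul_ne_zero frg_core_det_ne_zero (pow_ne_zero _ hY)
  -- the witness and its properties
  set G : MvPolynomial (MatIdx m × MatIdx m) ℂ :=
    (Matrix.of fun a b : Fin 2 × Fin m =>
        ∑ j : MatIdx m, T j a.1 b.1 • MvPolynomial.X (R := ℂ) (j, toLex (a.2, b.2))).det +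
      (Matrix.of fun a b : Fin 2 × Fin m =>
        ∑ j : MatIdx m, (T j)ᵀ a.1 b.1 • MvPolynomial.X (R := ℂ) (j, toLex (a.2, b.2))).det with hG
  obtain ⟨hGh, hGsand, hGtr⟩ := stub_symBlowup_mem m 2 T
  have hGp : MvPolynomial.eval p G ≠ 0 := by
    have hTt' : ∀ j, (T j)ᵀ = T j := fun j => congr_fun hTt j
    simp only [hG, hTt', map_add]
    intro h
    exact hdet (add_self_eq_zero.mp h)
  have hGs : ∀ M : Matrix (MatIdx m) (MatIdx m) ℂ, linSubst (MatIdx m) ℂ M (detFormLex ℂ m) = detFormLex ℂ m →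
      MvPolynomial.aeval (R := ℂ) (fun q : MatIdx m × MatIdx m =>
        ∑ l : MatIdx m, M l q.2 • (X (q.1, l) : MvPolynomial (MatIdx m × MatIdx m) ℂ)) G = G := by
    have hmem := explicit_le_stabInv m (Submodule.mem_inf.mpr ⟨by
        simp only [Submodule.mem_iInf, LinearMap.mem_ker, LinearMap.sub_apply, sub_eq_zero,
          AlgHom.toLinearMap_apply, LinearMap.id_coe, id_eq]
        exact hGsand, by
        simp only [LinearMap.mem_ker, LinearMap.sub_apply, sub_eq_zero, AlgHom.toLinearMap_apply,
          LinearMap.id_coe, id_eq]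
        exact hGtr⟩)
    exact CutBitesAdjugate.mem_iInf_ker_sub_id_iff.mp hmem
  exact ⟨G, p, hGh, hGs, hpU, hGp⟩

/-- **The cut bites in every even degree.**  Same hypotheses; for every `k` some `λ ⊢ m · (2k)` (`≤ m²` parts) has
`finrank T_U(t, λ*) < finrank T_U(0, λ*)` for every `t ≥ 1`, the truncation taken in degree `m · (2k)` (witness `G ^ k`).
[folklore] -/
theorem evenDegree_bite_of_mem {m : ℕ} {κ : Type*} [Fintype κ] [DecidableEq κ] (e : Fin 3 ⊕ κ ≃ Fin m)
    (Y : Matrix κ κ ℂ) (hY : Y.det ≠ 0) (U : Submodule ℂ (MatIdx m → ℂ))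
    (hP : (fun i : MatIdx m => Matrix.reindex e e
        (Matrix.fromBlocks (!![0, 1, 0; -1, 0, 0; 0, 0, 0] : Matrix (Fin 3) (Fin 3) ℂ) 0 0 (0 : Matrix κ κ ℂ))
        (ofLex i).1 (ofLex i).2) ∈ U)
    (hQ : (fun i : MatIdx m => Matrix.reindex e e
        (Matrix.fromBlocks (!![0, 0, 1; 0, 0, 0; -1, 0, 0] : Matrix (Fin 3) (Fin 3) ℂ) 0 0 (0 : Matrix κ κ ℂ))
        (ofLex i).1 (ofLex i).2) ∈ U)
    (hR : (fun i : MatIdx m => Matrix.reindex e e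
        (Matrix.fromBlocks (!![0, 0, 0; 0, 0, 1; 0, -1, 0] : Matrix (Fin 3) (Fin 3) ℂ) 0 0 (0 : Matrix κ κ ℂ))
        (ofLex i).1 (ofLex i).2) ∈ U)
    (hYU : (fun i : MatIdx m => Matrix.reindex e e
        (Matrix.fromBlocks (0 : Matrix (Fin 3) (Fin 3) ℂ) 0 0 Y) (ofLex i).1 (ofLex i).2) ∈ U)
    (k : ℕ) :
    ∃ lam : Nat.Partition (m * (2 * k)), lam.parts.card ≤ m * m ∧ ∀ t : ℕ, 0 < t →
      Module.finrank ℂ ↥(MvPolynomial.homogeneousSubmodule (MatIdx m × MatIdx m) ℂ (m * (2 * k))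
        ⊓ ((MvPolynomial.vanishingIdeal ℂ {p : MatIdx m × MatIdx m → ℂ |
              ∀ j : MatIdx m, (fun i => p (j, i)) ∈ U}) ^ t).restrictScalars ℂ
        ⊓ (⨅ (M : Matrix (MatIdx m) (MatIdx m) ℂ)
            (_ : linSubst (MatIdx m) ℂ M (detFormLex ℂ m) = detFormLex ℂ m),
            LinearMap.ker ((MvPolynomial.aeval (R := ℂ) fun p : MatIdx m × MatIdx m =>
              ∑ l : MatIdx m, M l p.2 • MvPolynomial.X (p.1, l)).toLinearMap
              - LinearMap.id (R := ℂ) (M := MvPolynomial (MatIdx m × MatIdx m) ℂ)))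
        ⊓ (⨅ (g : Matrix.GeneralLinearGroup (MatIdx m) ℂ) (_ : IsUpperTriangular g),
            LinearMap.ker ((MvPolynomial.aeval (R := ℂ) fun p : MatIdx m × MatIdx m =>
              ∑ l : MatIdx m, ((g⁻¹ : Matrix.GeneralLinearGroup (MatIdx m) ℂ) :
                Matrix (MatIdx m) (MatIdx m) ℂ) p.1 l • MvPolynomial.X (l, p.2)).toLinearMap
              - weightChar ((Weight.dualOfPartition (m * m) lam).toMatIdx) g •
                LinearMap.id (R := ℂ) (M := MvPolynomial (MatIdx m × MatIdx m) ℂ))))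
      < Module.finrank ℂ ↥(MvPolynomial.homogeneousSubmodule (MatIdx m × MatIdx m) ℂ (m * (2 * k))
        ⊓ ((MvPolynomial.vanishingIdeal ℂ {p : MatIdx m × MatIdx m → ℂ |
              ∀ j : MatIdx m, (fun i => p (j, i)) ∈ U}) ^ 0).restrictScalars ℂ
        ⊓ (⨅ (M : Matrix (MatIdx m) (MatIdx m) ℂ)
            (_ : linSubst (MatIdx m) ℂ M (detFormLex ℂ m) = detFormLex ℂ m),
            LinearMap.ker ((MvPolynomial.aeval (R := ℂ) fun p : MatIdx m × MatIdx m =>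
              ∑ l : MatIdx m, M l p.2 • MvPolynomial.X (p.1, l)).toLinearMap
              - LinearMap.id (R := ℂ) (M := MvPolynomial (MatIdx m × MatIdx m) ℂ)))
        ⊓ (⨅ (g : Matrix.GeneralLinearGroup (MatIdx m) ℂ) (_ : IsUpperTriangular g),
            LinearMap.ker ((MvPolynomial.aeval (R := ℂ) fun p : MatIdx m × MatIdx m =>
              ∑ l : MatIdx m, ((g⁻¹ : Matrix.GeneralLinearGroup (MatIdx m) ℂ) :
                Matrix (MatIdx m) (MatIdx m) ℂ) p.1 l • MvPolynomial.X (l, p.2)).toLinearMap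
              - weightChar ((Weight.dualOfPartition (m * m) lam).toMatIdx) g •
                LinearMap.id (R := ℂ) (M := MvPolynomial (MatIdx m × MatIdx m) ℂ)))) := by
  obtain ⟨G, p, hGh, hGs, hpU, hGp⟩ := frp_exists_witness_of_mem e Y hY U hP hQ hR hYU
  -- the power `G ^ k`: degree `m · (2k)`, invariant, non-zero at `p`
  have hGkh : (G ^ k).IsHomogeneous (m * (2 * k)) := by
    have := hGh.pow k
    rwa [show m * 2 * k = m * (2 * k) by ring] at this
  have hGks : ∀ M : Matrix (MatIdx m) (MatIdx m) ℂ, linSubst (MatIdx m) ℂ M (detFormLex ℂ m) = detFormLex ℂ m →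
      MvPolynomial.aeval (R := ℂ) (fun q : MatIdx m × MatIdx m =>
        ∑ l : MatIdx m, M l q.2 • (X (q.1, l) : MvPolynomial (MatIdx m × MatIdx m) ℂ)) (G ^ k) = G ^ k := by
    intro M hM
    rw [map_pow, hGs M hM]
  have hGkp : MvPolynomial.eval p (G ^ k) ≠ 0 := by
    rw [map_pow]
    exact pow_ne_zero _ hGp
  obtain ⟨lam, hcard, G', hG'h, hG's, hG'w, p', hp', hG'p'⟩ :=
    CutBitesAdjugate.stub_hwExtraction m (m * (2 * k)) U (G ^ k) hGkh hGks p hpU hGkp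
  refine ⟨lam, hcard, fun t ht => ?_⟩
  have : Module.Finite ℂ ↥(MvPolynomial.homogeneousSubmodule (MatIdx m × MatIdx m) ℂ (m * (2 * k))) :=
    Module.Finite.iff_fg.mpr (MvPolynomial.homogeneousSubmodule_fg _ ℂ _)
  refine CutBitesAdjugate.finrank_lt_of_eval_ne_zero ht ?_ hp' hG'p'
  refine Submodule.mem_inf.mpr ⟨Submodule.mem_inf.mpr ⟨Submodule.mem_inf.mpr ⟨?_, ?_⟩, ?_⟩, ?_⟩
  · exact (mem_homogeneousSubmodule _ _).mpr hG'h
  · rw [pow_zero, Ideal.one_eq_top, Submodule.restrictScalars_top]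
    exact Submodule.mem_top
  · exact CutBitesAdjugate.mem_iInf_ker_sub_id_iff.mpr hG's
  · exact CutBitesAdjugate.mem_iInf_ker_sub_smul_iff.mpr hG'w

/-- **In the crux's currency, every even degree.**  For every `m ≥ 3` and every `k ≥ 1` (`δ = 2k`) there are an
admissible centre `(U, r)` — the corner centre `Λ_3 ⊕ D_{m-3}`, every element of rank `≤ r = m - 1 < m`
(`cornerCentre_rank_le`) — and `λ ⊢ m · (2k)` (`≤ m²` parts) with
`finrank T_U((2k)(m-r), λ*) < finrank T_U(0, λ*)` (degree `m · (2k)`). [folklore] -/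
theorem evenDegree_admissibleCentre_bites (m : ℕ) (h3 : 3 ≤ m) (k : ℕ) (hk : 0 < k) :
    ∃ (U : Submodule ℂ (MatIdx m → ℂ)) (r : ℕ),
      (∀ u ∈ U, (Matrix.of fun a b : Fin m => u (toLex (a, b))).rank ≤ r) ∧ r < m ∧
      ∃ lam : Nat.Partition (m * (2 * k)), lam.parts.card ≤ m * m ∧
      (let χ : Weight (MatIdx m) := (Weight.dualOfPartition (m * m) lam).toMatIdx;
      let T : ℕ → Submodule ℂ (MvPolynomial (MatIdx m × MatIdx m) ℂ) := fun t =>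
        MvPolynomial.homogeneousSubmodule (MatIdx m × MatIdx m) ℂ (m * (2 * k))
        ⊓ ((MvPolynomial.vanishingIdeal ℂ {p : MatIdx m × MatIdx m → ℂ |
              ∀ j : MatIdx m, (fun i => p (j, i)) ∈ U}) ^ (t)).restrictScalars ℂ
        ⊓ (⨅ (M : Matrix (MatIdx m) (MatIdx m) ℂ)
            (_ : linSubst (MatIdx m) ℂ M (detFormLex ℂ m) = detFormLex ℂ m),
            LinearMap.ker ((MvPolynomial.aeval (R := ℂ) fun p : MatIdx m × MatIdx m =>
              ∑ l : MatIdx m, M l p.2 • MvPolynomial.X (p.1, l)).toLinearMap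
              - LinearMap.id (R := ℂ) (M := MvPolynomial (MatIdx m × MatIdx m) ℂ)))
        ⊓ (⨅ (g : Matrix.GeneralLinearGroup (MatIdx m) ℂ) (_ : IsUpperTriangular g),
            LinearMap.ker ((MvPolynomial.aeval (R := ℂ) fun p : MatIdx m × MatIdx m =>
              ∑ l : MatIdx m, ((g⁻¹ : Matrix.GeneralLinearGroup (MatIdx m) ℂ) :
                Matrix (MatIdx m) (MatIdx m) ℂ) p.1 l • MvPolynomial.X (l, p.2)).toLinearMap
              - weightChar χ g • LinearMap.id (R := ℂ) (M := MvPolynomial (MatIdx m × MatIdx m) ℂ)));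
      Module.finrank ℂ ↥(T (2 * k * (m - r))) < Module.finrank ℂ ↥(T 0)) := by
  obtain ⟨n, rfl⟩ := Nat.exists_eq_add_of_le h3
  have hA : ∀ (A : Matrix (Fin 3) (Fin 3) ℂ), Aᵀ = -A → ∀ i j, A i j = -A j i := fun A hA i j => by
    have := congr_fun (congr_fun hA j) i
    simpa only [Matrix.transpose_apply, Matrix.neg_apply] using this
  have h0 : ∀ i j : Fin n, i ≠ j → (0 : Matrix (Fin n) (Fin n) ℂ) i j = 0 := fun _ _ _ => rfl
  have h1 : ∀ i j : Fin n, i ≠ j → (1 : Matrix (Fin n) (Fin n) ℂ) i j = 0 := fun _ _ h => Matrix.one_apply_ne h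
  have hz : ∀ i j : Fin 3, (0 : Matrix (Fin 3) (Fin 3) ℂ) i j = -(0 : Matrix (Fin 3) (Fin 3) ℂ) j i := by simp
  obtain ⟨lam, hcard, hlt⟩ := evenDegree_bite_of_mem finSumFinEquiv (1 : Matrix (Fin n) (Fin n) ℂ)
    (by rw [Matrix.det_one]; exact one_ne_zero) _
    (frc_mem_cornerCentre (hA _ frc_sP_transpose) h0) (frc_mem_cornerCentre (hA _ frc_sQ_transpose) h0)
    (frc_mem_cornerCentre (hA _ frc_sR_transpose) h0) (frc_mem_cornerCentre hz h1) k
  refine ⟨_, 3 + n - 1, cornerCentre_rank_le n, by omega, lam, hcard, ?_⟩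
  have h2 : 2 * k * (3 + n - (3 + n - 1)) = 2 * k := by
    rw [show 3 + n - (3 + n - 1) = 1 by omega, mul_one]
  dsimp only
  rw [h2]
  exact hlt (2 * k) (by omega)

end

end Summit.ValiantsHypothesis.ValiantsHypothesis.Theorems.ValuativeFlip
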